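import Summits.MatrixMultiplication.MatrixMultiplication.Theorems.OutsiderSandwichLevelRateTwo
import HarnessLib

/-!
# Dieudonné's theorem, determinant-free: a singular subspace of `M_n(ℂ)` has `dim ≤ n² − n`

Route `OutsiderSandwich` (decomposition cell `decomp-mm`, lens 4 «minimal counterexample /
extremal reduction», gen 28, addendum), support for the aside leaf `BlockOneIsMM`
(stmt-MatrixMultiplication-27147): the input that lifts the unconditional core bound of
`OutsiderSandwichLevelRateTwo` from `2n² − 4` to `2n² − 2n` (`OutsiderSandwichLevelRateThree`).

**Theorem** (`finrank_add_card_le`, Dieudonné 1949).  A linear subspace `V ≤ M_n(ℂ)` none of whose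
elements is invertible satisfies `dim V + n ≤ n²`.

Proof (no determinants, no eigenvalues).  Suppose `codim V = k ≤ n − 1`.  (1) Exchange: there is
a set `S` of `k` matrix units with `V + span S = M_n` (`exists_units_complement`).  (2) A greedy
combinatorial lemma (`exists_order`): for `|S| ≤ n − 1` cells there are a permutation `π` and a
potential `f` with `f(π i) < f(j)` for every cell `(i, j) ∈ S` — process an `S`-free column `j₀`
together with a row `i₀` carrying a cell, put `π(i₀) = j₀`, give `j₀` the lowest potential, recurse
on the board minus row `i₀` and column `j₀`, which carries at most `|S| − 1` cells.  (3) Write the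
permutation matrix `P_π = v + N` with `v ∈ V` and `N` supported on `S`; then `P_π⁻¹N` is strictly
triangular for the potential `f`, hence nilpotent, so `v = P_π(1 − P_π⁻¹N)` is invertible —
contradiction.

## References
* P. Bürgisser, M. Clausen, M. A. Shokrollahi, *Algebraic Complexity Theory*, Springer (1997),
  §17.1 (substitution and spaces of matrices of bounded rank). [BurgisserClausenShokrollahi1997]
* D. Coppersmith, S. Winograd, *Matrix multiplication via arithmetic progressions*,
  J. Symbolic Comput. 9 (1990) 251–280, §7. [CoppersmithWinograd1990]
-/

noncomputable section
open scoped BigOperators Matrix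
set_option linter.dupNamespace false
set_option autoImplicit false

namespace Summit.MatrixMultiplication.MatrixMultiplication.Theorems.OutsiderSandwichDieudonne

variable {ρ : Type} [Fintype ρ] [DecidableEq ρ]

/-! ## 1. Strictly triangular matrices for a potential are nilpotent -/

/-- Powers of a matrix that is strictly triangular for a potential `f` climb the potential.
[folklore] -/
theorem pow_apply_ne_zero {f : ρ → ℕ} {T : Matrix ρ ρ ℂ} (hT : ∀ a b, T a b ≠ 0 → f a < f b) :
    ∀ (k : ℕ) (a b : ρ), (T ^ k) a b ≠ 0 → f a + k ≤ f b := by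
  intro k
  induction k with
  | zero =>
    intro a b h
    rw [pow_zero, Matrix.one_apply] at h
    by_cases hab : a = b
    · subst hab; simp
    · exact absurd (if_neg hab) h
  | succ k ih =>
    intro a b h
    rw [pow_succ, Matrix.mul_apply] at h
    obtain ⟨c, -, hc⟩ := Finset.exists_ne_zero_of_sum_ne_zero h
    obtain ⟨h1, h2⟩ := mul_ne_zero_iff.1 hc
    have e1 := ih a c h1
    have e2 := hT c b h2
    omega

/-- A matrix that is strictly triangular for a potential is nilpotent, so `1 − T` is a unit.
[folklore] -/
theorem isUnit_one_sub {f : ρ → ℕ} {T : Matrix ρ ρ ℂ} (hT : ∀ a b, T a b ≠ 0 → f a < f b) :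
    IsUnit (1 - T) := by
  refine IsNilpotent.isUnit_one_sub ⟨Finset.univ.sup f + 1, ?_⟩
  ext a b
  rw [Matrix.zero_apply]
  by_contra h
  have h1 := pow_apply_ne_zero hT _ a b h
  have h2 : f b ≤ Finset.univ.sup f := Finset.le_sup (Finset.mem_univ b)
  omega

/-- **Perturbed permutation matrices.**  If `N a b ≠ 0 ⟹ f(π a) < f(b)` then `P_π − N` is
invertible. [folklore] -/
theorem exists_perm_sub_mul_eq_one (π : Equiv.Perm ρ) (f : ρ → ℕ) (N : Matrix ρ ρ ℂ)
    (hN : ∀ a b, N a b ≠ 0 → f (π a) < f b) :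
    ∃ B : Matrix ρ ρ ℂ, ((π.toPEquiv.toMatrix : Matrix ρ ρ ℂ) - N) * B = 1 := by
  let P : Matrix ρ ρ ℂ := π.toPEquiv.toMatrix
  let P' : Matrix ρ ρ ℂ := π.symm.toPEquiv.toMatrix
  have hPP' : P * P' = 1 := by
    simp only [P, P']
    rw [← PEquiv.toMatrix_trans, ← Equiv.toPEquiv_trans, Equiv.self_trans_symm,
      Equiv.toPEquiv_refl, PEquiv.toMatrix_refl]
  have hT : ∀ a b, (P' * N) a b ≠ 0 → f a < f b := by
    intro a b h
    have e : (P' * N) a b = N (π.symm a) b := by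
      simp only [P']
      rw [PEquiv.toMatrix_toPEquiv_mul]; rfl
    rw [e] at h
    simpa using hN _ _ h
  obtain ⟨B₀, hB₀⟩ := (isUnit_one_sub hT).exists_right_inv
  refine ⟨B₀ * P', ?_⟩
  have e : P - N = P * (1 - P' * N) := by
    rw [mul_sub, mul_one, ← mul_assoc, hPP', one_mul]
  show (P - N) * (B₀ * P') = 1
  rw [e, mul_assoc, ← mul_assoc (1 - P' * N), hB₀, one_mul, hPP']

/-! ## 2. The greedy combinatorial lemma -/

omit [Fintype ρ] in
/-- **Greedy ordering.**  On an `r × r` board `R × C` carrying fewer than `r` cells `S` (or none)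
there are an injection `g : R → C` and a potential `f` with `f(g i) < f(j)` for every cell
`(i, j) ∈ S`. [folklore] -/
theorem exists_order : ∀ (r : ℕ) (R C : Finset ρ) (S : Finset (ρ × ρ)),
    R.card = r → C.card = r → (∀ s ∈ S, s.1 ∈ R ∧ s.2 ∈ C) → (S.card < r ∨ S = ∅) →
    ∃ (g : ρ → ρ) (f : ρ → ℕ), (∀ x ∈ R, g x ∈ C) ∧ (∀ x ∈ R, ∀ x' ∈ R, g x = g x' → x = x') ∧
      (∀ s ∈ S, f (g s.1) < f s.2) := by
  intro r
  induction r with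
  | zero =>
    intro R C S hR _ hS _
    have hR0 : R = ∅ := Finset.card_eq_zero.1 hR
    refine ⟨id, fun _ => 0, fun x hx => ?_, fun x _ x' _ h => h, fun s hs => ?_⟩
    · rw [hR0] at hx; exact absurd hx (Finset.notMem_empty x)
    · have := (hS s hs).1; rw [hR0] at this; exact absurd this (Finset.notMem_empty _)
  | succ r ih =>
    intro R C S hR hC hS hcard
    have hSc : S.card < r + 1 := by
      rcases hcard with h | h
      · exact h
      · rw [h, Finset.card_empty]; omega
    -- an `S`-free column `j₀`
    obtain ⟨j₀, hj₀C, hj₀⟩ : ∃ j₀ ∈ C, j₀ ∉ S.image Prod.snd :=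
      Finset.exists_mem_notMem_of_card_lt_card
        (lt_of_le_of_lt Finset.card_image_le (by rw [hC]; exact hSc))
    have hj₀' : ∀ s ∈ S, s.2 ≠ j₀ := fun s hs e =>
      hj₀ (Finset.mem_image.2 ⟨s, hs, e⟩)
    -- a row `i₀`, carrying a cell if there is one
    have hRne : R.Nonempty := by rw [← Finset.card_pos, hR]; omega
    obtain ⟨i₀, hi₀R, hi₀⟩ : ∃ i₀ ∈ R, S = ∅ ∨ ∃ s₀ ∈ S, s₀.1 = i₀ := by
      by_cases hS0 : S = ∅
      · obtain ⟨i₀, hi₀⟩ := hRne; exact ⟨i₀, hi₀, Or.inl hS0⟩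
      · obtain ⟨s₀, hs₀⟩ := Finset.nonempty_iff_ne_empty.2 hS0
        exact ⟨s₀.1, (hS s₀ hs₀).1, Or.inr ⟨s₀, hs₀, rfl⟩⟩
    -- the smaller board
    let R' := R.erase i₀
    let C' := C.erase j₀
    let S' := S.filter fun s => s.1 ≠ i₀
    have hR' : R'.card = r := by
      simp only [R']; rw [Finset.card_erase_of_mem hi₀R, hR]; rfl
    have hC' : C'.card = r := by
      simp only [C']; rw [Finset.card_erase_of_mem hj₀C, hC]; rfl
    have hS' : ∀ s ∈ S', s.1 ∈ R' ∧ s.2 ∈ C' := by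
      intro s hs
      obtain ⟨hsS, hs1⟩ := Finset.mem_filter.1 hs
      exact ⟨Finset.mem_erase.2 ⟨hs1, (hS s hsS).1⟩,
        Finset.mem_erase.2 ⟨hj₀' s hsS, (hS s hsS).2⟩⟩
    have hcard' : S'.card < r ∨ S' = ∅ := by
      rcases hi₀ with h | ⟨s₀, hs₀, hs₀1⟩
      · right
        simp only [S']; rw [h]; rfl
      · left
        have hlt : S'.card < S.card := by
          apply Finset.card_lt_card
          refine Finset.filter_ssubset.2 ⟨s₀, hs₀, ?_⟩
          simp [hs₀1]
        omega
    obtain ⟨g', f', hg'C, hg'inj, hg'f⟩ := ih R' C' S' hR' hC' hS' hcard'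
    -- extend
    refine ⟨fun x => if x = i₀ then j₀ else g' x,
      fun y => if y = j₀ then 0 else f' y + 1, ?_, ?_, ?_⟩
    · intro x hx
      by_cases hxi : x = i₀
      · simp only [hxi, if_true]; exact hj₀C
      · simp only [hxi, if_false]
        exact Finset.mem_of_mem_erase (hg'C x (Finset.mem_erase.2 ⟨hxi, hx⟩))
    · intro x hx x' hx' h
      by_cases hxi : x = i₀
      · by_cases hxi' : x' = i₀
        · rw [hxi, hxi']
        · simp only [hxi, if_true, hxi', if_false] at h
          have := hg'C x' (Finset.mem_erase.2 ⟨hxi', hx'⟩)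
          rw [← h] at this
          exact absurd this (Finset.notMem_erase j₀ C)
      · by_cases hxi' : x' = i₀
        · simp only [hxi, if_false, hxi', if_true] at h
          have := hg'C x (Finset.mem_erase.2 ⟨hxi, hx⟩)
          rw [h] at this
          exact absurd this (Finset.notMem_erase j₀ C)
        · simp only [hxi, if_false, hxi'] at h
          exact hg'inj x (Finset.mem_erase.2 ⟨hxi, hx⟩) x' (Finset.mem_erase.2 ⟨hxi', hx'⟩) h
    · intro s hs
      have hs2 : s.2 ≠ j₀ := hj₀' s hs
      by_cases hs1 : s.1 = i₀
      · simp only [hs1, if_true, hs2, if_false]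
        omega
      · have hsS' : s ∈ S' := Finset.mem_filter.2 ⟨hs, hs1⟩
        have hg1 : g' s.1 ≠ j₀ := by
          intro e
          have := hg'C s.1 (hS' s hsS').1
          rw [e] at this
          exact Finset.notMem_erase j₀ C this
        simp only [hs1, if_false, hg1, hs2]
        have := hg'f s hsS'
        omega

/-- **Greedy ordering, square form.**  Fewer than `n` cells admit a permutation `π` and a
potential `f` with `f(π i) < f(j)` on every cell. [folklore] -/
theorem exists_perm_order (S : Finset (ρ × ρ)) (hS : S.card < Fintype.card ρ) :
    ∃ (π : Equiv.Perm ρ) (f : ρ → ℕ), ∀ s ∈ S, f (π s.1) < f s.2 := by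
  obtain ⟨g, f, -, hinj, hf⟩ := exists_order (Fintype.card ρ) Finset.univ Finset.univ S
    Finset.card_univ Finset.card_univ (fun s _ => ⟨Finset.mem_univ _, Finset.mem_univ _⟩)
    (Or.inl hS)
  have hginj : Function.Injective g := fun x x' h =>
    hinj x (Finset.mem_univ _) x' (Finset.mem_univ _) h
  refine ⟨Equiv.ofBijective g (Finite.injective_iff_bijective.1 hginj), f, fun s hs => ?_⟩
  rw [Equiv.ofBijective_apply]
  exact hf s hs

/-! ## 3. Matrix units complementing a subspace -/

/-- The matrix units indexed by `S`. [folklore] -/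
def units (S : Finset (ρ × ρ)) : Set (Matrix ρ ρ ℂ) :=
  (fun s : ρ × ρ => Matrix.single s.1 s.2 (1 : ℂ)) '' (S : Set (ρ × ρ))

omit [Fintype ρ] in
/-- An element of `span (units S)` is supported on `S`. [folklore] -/
theorem apply_eq_zero_of_mem_span {S : Finset (ρ × ρ)} {N : Matrix ρ ρ ℂ}
    (hN : N ∈ Submodule.span ℂ (units S)) (a b : ρ) (hab : (a, b) ∉ S) : N a b = 0 := by
  induction hN using Submodule.span_induction with
  | mem x hx =>
    obtain ⟨s, hs, rfl⟩ := hx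
    show Matrix.single s.1 s.2 (1 : ℂ) a b = 0
    rw [Matrix.single_apply, if_neg]
    rintro ⟨rfl, rfl⟩
    exact hab (Finset.mem_coe.1 hs)
  | zero => rfl
  | add x y _ _ hx hy => rw [Matrix.add_apply, hx, hy, add_zero]
  | smul c x _ hx => rw [Matrix.smul_apply, hx, smul_zero]

/-- **Exchange.**  A subspace of codimension `k` is complemented by (at most) `k` matrix units.
[folklore] -/
theorem exists_units_complement : ∀ (k : ℕ) (V : Submodule ℂ (Matrix ρ ρ ℂ)),
    Module.finrank ℂ V + k = Fintype.card ρ ^ 2 →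
      ∃ S : Finset (ρ × ρ), S.card ≤ k ∧ V ⊔ Submodule.span ℂ (units S) = ⊤ := by
  have hM : Module.finrank ℂ (Matrix ρ ρ ℂ) = Fintype.card ρ ^ 2 := by
    rw [Module.finrank_matrix, Module.finrank_self, mul_one, sq]
  intro k
  induction k with
  | zero =>
    intro V hV
    refine ⟨∅, le_rfl, ?_⟩
    rw [Submodule.eq_top_of_finrank_eq (S := V) (by rw [hM]; omega)]
    exact top_sup_eq _
  | succ k ih =>
    intro V hV
    -- some matrix unit is missing from `V`
    obtain ⟨i, j, hij⟩ : ∃ i j, Matrix.single i j (1 : ℂ) ∉ V := by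
      by_contra hall
      push Not at hall
      have htop : V = ⊤ := by
        refine eq_top_iff.2 fun X _ => ?_
        rw [Matrix.matrix_eq_sum_single X]
        refine Submodule.sum_mem _ fun a _ => Submodule.sum_mem _ fun b _ => ?_
        have e : Matrix.single a b (X a b) = (X a b) • Matrix.single a b (1 : ℂ) := by
          rw [Matrix.smul_single, smul_eq_mul, mul_one]
        rw [e]
        exact V.smul_mem _ (hall a b)
      rw [htop, finrank_top, hM] at hV
      omega
    let V' := V ⊔ Submodule.span ℂ {Matrix.single i j (1 : ℂ)}
    have hlt : V < V' :=
      SetLike.lt_iff_le_and_exists.2 ⟨le_sup_left, _,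
        Submodule.mem_sup_right (Submodule.mem_span_singleton_self _), hij⟩
    have h1 := Submodule.finrank_lt_finrank_of_lt hlt
    have hE : Matrix.single i j (1 : ℂ) ≠ 0 := fun h => hij (h ▸ V.zero_mem)
    have h2 : Module.finrank ℂ V' ≤ Module.finrank ℂ V + 1 := by
      have e := Submodule.finrank_add_le_finrank_add_finrank V
        (Submodule.span ℂ {Matrix.single i j (1 : ℂ)})
      rw [finrank_span_singleton hE] at e
      exact e
    have hV' : Module.finrank ℂ V' + k = Fintype.card ρ ^ 2 := by omega
    obtain ⟨S', hS'card, hS'top⟩ := ih V' hV'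
    refine ⟨insert (i, j) S', (Finset.card_insert_le _ _).trans (by omega), ?_⟩
    refine eq_top_iff.2 (hS'top.symm.le.trans (sup_le (sup_le le_sup_left ?_) ?_))
    · refine le_sup_right.trans' (Submodule.span_mono ?_)
      rintro _ rfl
      exact ⟨(i, j), Finset.mem_coe.2 (Finset.mem_insert_self _ _), rfl⟩
    · exact le_sup_right.trans' (Submodule.span_mono (Set.image_mono
        (Finset.coe_subset.2 (Finset.subset_insert _ _))))

/-! ## 4. Dieudonné's theorem -/

/-- **Dieudonné's theorem** (determinant-free form): a subspace of `M_n(ℂ)` without invertible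
elements has `dim V + n ≤ n²`. [cite: BurgisserClausenShokrollahi1997, §17.1] -/
theorem finrank_add_card_le (V : Submodule ℂ (Matrix ρ ρ ℂ))
    (hV : ∀ A ∈ V, ∀ B : Matrix ρ ρ ℂ, A * B ≠ 1) :
    Module.finrank ℂ V + Fintype.card ρ ≤ Fintype.card ρ ^ 2 := by
  have hM : Module.finrank ℂ (Matrix ρ ρ ℂ) = Fintype.card ρ ^ 2 := by
    rw [Module.finrank_matrix, Module.finrank_self, mul_one, sq]
  have hle := Submodule.finrank_le V
  rw [hM] at hle
  by_contra hlt
  obtain ⟨S, hScard, hStop⟩ :=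
    exists_units_complement (Fintype.card ρ ^ 2 - Module.finrank ℂ V) V (by omega)
  obtain ⟨π, f, hf⟩ := exists_perm_order S (by omega)
  -- decompose the permutation matrix along `V + span (units S)`
  have hY : (π.toPEquiv.toMatrix : Matrix ρ ρ ℂ) ∈ V ⊔ Submodule.span ℂ (units S) := by
    rw [hStop]; exact Submodule.mem_top
  obtain ⟨v, hv, N, hN, hvN⟩ := Submodule.mem_sup.1 hY
  have hvN' : v = π.toPEquiv.toMatrix - N := eq_sub_of_add_eq hvN
  obtain ⟨B, hB⟩ := exists_perm_sub_mul_eq_one π f N fun a b hab => by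
    have hmem : (a, b) ∈ S := by
      by_contra h
      exact hab (apply_eq_zero_of_mem_span hN a b h)
    exact hf (a, b) hmem
  exact hV v hv B (hvN' ▸ hB)

end Summit.MatrixMultiplication.MatrixMultiplication.Theorems.OutsiderSandwichDieudonne
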